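import Summits.AnomalousDissipation.AnomalousDissipation.Theorems.WindLineWindyGalerkinSteadyZerothLawGenericLeafNondegeneracyToolsB
import Summits.AnomalousDissipation.AnomalousDissipation.Theorems.WindLineWindyGalerkinSteadyZerothLawGenericLeafNondegeneracyToolsD

/-!
# Generic leaf-nondegeneracy (stub B of crux `WindLine.WindyGalerkinSteadyZerothLaw`,
# stmt-AnomalousDissipation-11414): the nondegenerate parameters form an OPEN set

The OPENNESS HALF of stub B (pure proof file, no definitions).  For `ν > 0` and a momentum `m`,
the set of admissible parameters `c ∈ 𝒜` all of whose classical steady states of `NS_ν(F⟦c⟧)` with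
`∫ u = m` are leaf-nondegenerate (`¬ IsLinNSEigenvalue ν u 0`) is open in `𝒜`
(`isOpen_leafNondegenerate`, registered sub-goal `genericLeaf_open`).

Proof (Foias–Temam 1977 §1: the regular values of the proper Fredholm steady map are open, pulled
back along the continuous force map of `𝒜`).  The complement is sequentially closed: let `cₙ → c`
carry degenerate steady states `uₙ` of momentum `m`, with state vectors `xₙ ∈ W`
(`4π²ν xₙ + D_M xₙ + B(xₙ,xₙ) = Y cₙ`, `M = m` complexified; tools C).  By the a priori bound
(tools D) the `xₙ` are `W`-bounded, and `Y cₙ → Y c`; properness (tools B) gives `x_{φ n} → z` with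
`4π²ν z + D z + B(z,z) = Y c`, and `z` is the state vector of a classical steady state `u` of
`NS_ν(F⟦c⟧)` with `∫ u = m` (tools C).  If `c` were good, `u` would be nondegenerate, so the lattice
linearisation `T(z) = 4π²ν + D + K_z` is injective (`stub_linearisationInjective`), hence invertible
(compact perturbation of `4π²ν`, `SteadyLattice.exists_equiv_of_injective`); invertibility is open
and `x ↦ T(x)` is continuous, so `T(x_{φ n})` is invertible for large `n` — contradicting the non-zero
lattice kernel vector produced from the degenerate `u_{φ n}` (tools C, `exists_kernel_of_isLinNSEigenvalue`).

References: Foias–Temam, CPAM 30 (1977) §1; Saut–Temam, Indiana Univ. Math. J. 29 (1980) §2;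
Temam 1979 Ch. II §1 Thm. 1.3.
-/

noncomputable section

-- D-0017: single-problem summit ⇒ the duplicated namespace segment is by design.
set_option linter.dupNamespace false

open scoped BigOperators Topology ENNReal NNReal InnerProductSpace ComplexConjugate
open Filter Set Function TopologicalSpace MeasureTheory UnitAddTorus
open Literature.Analysis.FunctionSpaces Literature.Analysis.FunctionSpaces.Torus
open Literature.Analysis.FunctionSpaces.EuclideanSpace
open Literature.Analysis.FluidPDE Literature.Analysis.FluidPDE.Torus
open Literature.Analysis.FluidPDE.ScalarFourier
open Literature.Analysis.FluidPDE.SteadyLattice Literature.Analysis.FluidPDE.SteadyLatticeDrift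

namespace Summit.AnomalousDissipation.AnomalousDissipation.Theorems.WindLineWindyGalerkinSteadyZerothLaw.GenericLeaf

/-- The flat three-torus (local notation). -/
local notation "𝕋³" => UnitAddTorus (Fin 3)
/-- Velocity values (local notation). -/
local notation "E³" => EuclideanSpace ℝ (Fin 3)
/-- Complex coefficient vectors (local notation). -/
local notation "ℂ³" => EuclideanSpace ℂ (Fin 3)
/-- Square-summable coefficient families `ℤ³ → ℂ³` (local notation). -/
local notation "ℓ2" => lp (fun _ : Fin 3 → ℤ => EuclideanSpace ℂ (Fin 3)) 2
/-- Physical coefficients `x̌(k) = x(k)/|k|²` of a family (local notation, the tree's `cf`). -/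
local notation "cf[" X "]" =>
  ((fun mm : Fin 3 → ℤ => (((freqNormSq mm)⁻¹ : ℝ) : ℂ)) • (X : (Fin 3 → ℤ) → EuclideanSpace ℂ (Fin 3)))
/-- `k · v = ∑ⱼ kⱼ vⱼ` (local notation, the tree's `kdot`). -/
local notation "kdot[" k "," v "]" =>
  (∑ jj : Fin 3, (((k : Fin 3 → ℤ) jj : ℤ) : ℂ) * (v : EuclideanSpace ℂ (Fin 3)) jj)
/-- The convective symbol `N(a, b)(k)` as a vector of `ℂ³` (local notation, the tree's `nl`). -/
local notation "nl[" a "," b "," k "]" =>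
  ((WithLp.toLp 2 (fun pp : Fin 3 => transportSym (fun jj mm => (a : (Fin 3 → ℤ) → EuclideanSpace ℂ (Fin 3)) mm jj)
    (fun mm => (b : (Fin 3 → ℤ) → EuclideanSpace ℂ (Fin 3)) mm pp) k)) : EuclideanSpace ℂ (Fin 3))
set_option quotPrecheck false in
/-- admissible parameters -/
local notation "𝒜" => ({c : SymL2 (Fin 3) | c 0 = 0 ∧
  ∀ k : Fin 3 → ℤ, ∑ j : Fin 3, ((k j : ℤ) : ℂ) * c k j = 0} : Set (SymL2 (Fin 3)))
/-- the force of a parameter -/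
local notation "F⟦" c "⟧" => SymL2.field (fun k : Fin 3 → ℤ => Real.exp (freqNormSq k)) (c : SymL2 (Fin 3))

/-! ## §1 The lattice linearisation as a continuous operator-valued map -/

section Linearisation

variable {E : Type*} [NormedAddCommGroup E] [NormedSpace ℝ E] (B : E → E → E)
  (hBb : IsBoundedBilinearMap ℝ (fun p : E × E => B p.1 p.2))

/-- `K_x w = B(x,w) + B(w,x)` for `K_x = DB(x,x) ∘ (id, id)`. [folklore] -/
theorem linOp_apply (x w : E) :
    ((hBb.deriv (x, x)).comp ((ContinuousLinearMap.id ℝ E).prod (ContinuousLinearMap.id ℝ E))) w = B x w + B w x := by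
  simp [IsBoundedBilinearMap.deriv_apply]

/-- `x ↦ K_x` is continuous into `E →L E` (the derivative of a bounded bilinear map is a bounded
linear function of the base point, and composition with a fixed map is continuous). [folklore] -/
theorem continuous_linOp :
    Continuous fun x : E => (hBb.deriv (x, x)).comp ((ContinuousLinearMap.id ℝ E).prod (ContinuousLinearMap.id ℝ E)) := by
  have h1 : Continuous fun x : E => hBb.deriv (x, x) :=
    hBb.isBoundedLinearMap_deriv.continuous.comp (continuous_id.prodMk continuous_id)
  exact (isBoundedBilinearMap_comp (𝕜 := ℝ) (E := E) (F := E × E) (G := E)).continuous.comp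
    (h1.prodMk continuous_const)

/-- `x ↦ T(x) = c·1 + (D + K_x)` is continuous into `E →L E`. [folklore] -/
theorem continuous_linearisation (D : E →L[ℝ] E) (c : ℝ) :
    Continuous fun x : E => c • ContinuousLinearMap.id ℝ E +
      (D + (hBb.deriv (x, x)).comp ((ContinuousLinearMap.id ℝ E).prod (ContinuousLinearMap.id ℝ E))) := by
  have h := continuous_linOp B hBb
  fun_prop

/-- `T(x) w = c w + (D + K_x) w`. [folklore] -/
theorem linearisation_apply (D : E →L[ℝ] E) (c : ℝ) (x w : E) :
    (c • ContinuousLinearMap.id ℝ E +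
        (D + (hBb.deriv (x, x)).comp ((ContinuousLinearMap.id ℝ E).prod (ContinuousLinearMap.id ℝ E)))) w =
      c • w + (D + (hBb.deriv (x, x)).comp ((ContinuousLinearMap.id ℝ E).prod (ContinuousLinearMap.id ℝ E))) w := by
  simp

end Linearisation

/-! ## §2 Openness of the nondegenerate parameters -/

/-- **The nondegenerate parameters form an open set** (openness half of stub B; Foias–Temam 1977 §1).
For `ν > 0` and `m ∈ ℝ³`, `{c ∈ 𝒜 | every classical steady state (u,p) of NS_ν(F⟦c⟧) with ∫ u = m has
¬ IsLinNSEigenvalue ν u 0}` is open in `𝒜`.  See the module docstring for the proof. [folklore] -/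
theorem isOpen_leafNondegenerate (ν : ℝ) (m : E³) (hν : 0 < ν) :
    IsOpen {c : 𝒜 | ∀ (u : 𝕋³ → E³) (p : 𝕋³ → ℝ),
      IsSteadyNSState ν F⟦c⟧ u p → ∫ x, u x = m → ¬ IsLinNSEigenvalue ν u 0} := by
  rw [← isClosed_compl_iff]
  refine IsSeqClosed.isClosed fun c c₀ hcmem hc => ?_
  -- the degenerate witnesses along the sequence
  have hcmem' : ∀ n, ∃ (u : 𝕋³ → E³) (p : 𝕋³ → ℝ), IsSteadyNSState ν F⟦c n⟧ u p ∧ ∫ x, u x = m ∧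
      IsLinNSEigenvalue ν u 0 := by
    intro n
    have h := hcmem n
    simp only [mem_compl_iff, mem_setOf_eq, not_forall, not_not, exists_prop] at h
    obtain ⟨u, p, hst, hm, hev⟩ := h
    exact ⟨u, p, hst, hm, hev⟩
  choose u p hst hmean hev using hcmem'
  have hu : ∀ n, IsSmooth (u n) := fun n => steady_isSmooth (hst n)
  have hdiv : ∀ n, IsDivFree (u n) := fun n => steady_isDivFree (hst n)
  -- the lattice set-up
  set M : ℂ³ := complexify m with hMdef
  have hMc : conjVec M = M := conjVec_complexify m
  have hMn : ∀ n, mFourierCoeff (complexify ∘ u n) 0 = M := fun n => by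
    rw [mFourierCoeff_complexify_zero (hu n), hmean n]
  obtain ⟨W, hW, hWc⟩ := exists_space
  haveI : CompleteSpace W := completeSpace_W hWc
  obtain ⟨B, hB, hBb⟩ := exists_bilinear hW
  obtain ⟨D, hD, hDc⟩ := exists_drift hW hWc hMc
  obtain ⟨Y, hY, hYn, hYlip⟩ := exists_forceVecMap hW
  set cν : ℝ := 4 * Real.pi ^ 2 * ν with hcν
  have hcν0 : 0 < cν := by positivity
  -- state vectors and their equations
  choose x hx hcfx using fun n => exists_stateVec hW (hu n) (hdiv n)
  have heq : ∀ n, cν • x n + D (x n) + B (x n) (x n) = Y (c n) := fun n =>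
    steadyMap_stateVec_eq B hB D hD (hst n) (hMn n) (x n) (hx n) (Y (c n)) (hY (c n))
  -- a priori bound
  have hcs : Tendsto (fun n => ((c n : 𝒜) : SymL2 (Fin 3))) atTop (𝓝 (c₀ : SymL2 (Fin 3))) :=
    (continuous_subtype_val.tendsto c₀).comp hc
  obtain ⟨K, hK⟩ := (hcs.norm).bddAbove_range
  have hKn : ∀ n, ‖((c n : 𝒜) : SymL2 (Fin 3))‖ ≤ K := fun n => hK ⟨n, rfl⟩
  obtain ⟨R, hR⟩ := exists_norm_stateVec_le hW B hB D hD hν K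
  have hxR : ∀ n, ‖x n‖ ≤ R := fun n => hR (c n) (hKn n) (u n) (p n) (hst n) (hMn n) (x n) (hx n)
  -- `Y cₙ → Y c₀`
  have hYc : Continuous Y := by
    refine (LipschitzWith.of_dist_le_mul (K := 1) fun a b => ?_).continuous
    rw [NNReal.coe_one, one_mul, dist_eq_norm, Subtype.dist_eq, dist_eq_norm]
    exact hYlip a b
  have hy : Tendsto (fun n => cν • x n + D (x n) + B (x n) (x n)) atTop (𝓝 (Y c₀)) := by
    simp_rw [heq]
    exact (hYc.tendsto c₀).comp hc
  -- properness: a convergent subsequence, and the limit steady state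
  obtain ⟨φ, z, hφ, hz, hGz⟩ := exists_tendsto_subseq_of_bounded B hB hBb D hD hWc hcν0 x hxR hy
  obtain ⟨u₀, p₀, hst₀, hu₀, hû₀⟩ := exists_steadyState_of_latticeEq hW B hB D hD hMc hν c₀ z (Y c₀) (hY c₀) hGz
  have hu₀0 : mFourierCoeff (complexify ∘ u₀) 0 = M := by
    rw [hû₀, Pi.add_apply, cf_zero, zero_add, Pi.single_eq_same]
  have hmean₀ : ∫ y, u₀ y = m := by
    have h := hu₀0
    rw [mFourierCoeff_complexify_zero hu₀, hMdef] at h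
    exact complexify_injective h
  have hcfz : cf[((z : ℓ2) : (Fin 3 → ℤ) → ℂ³)] = Function.update (mFourierCoeff (complexify ∘ u₀)) 0 0 := by
    rw [hû₀, update_add_single_of_zero (cf_zero _) M]
  -- suppose `c₀` were good: then `u₀` is nondegenerate and `T(z)` is invertible
  rw [mem_compl_iff]
  intro hgood
  have hnd : ¬ IsLinNSEigenvalue ν u₀ 0 := hgood u₀ p₀ hst₀ hmean₀
  obtain ⟨Kx, hKx⟩ : ∃ Kx : W → (W →L[ℝ] W), Kx = fun w =>
      (hBb.deriv (w, w)).comp ((ContinuousLinearMap.id ℝ W).prod (ContinuousLinearMap.id ℝ W)) := ⟨_, rfl⟩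
  have hKxw : ∀ w v, Kx w v = B w v + B v w := fun w v => by rw [hKx]; exact linOp_apply B hBb w v
  obtain ⟨T, hT⟩ : ∃ T : W → (W →L[ℝ] W), T = fun w => cν • ContinuousLinearMap.id ℝ W + (D + Kx w) := ⟨_, rfl⟩
  have hTw : ∀ w v, T w v = cν • v + (D + Kx w) v := fun w v => by
    rw [hT, hKx]; exact linearisation_apply B hBb D cν w v
  have hTc : Continuous T := by rw [hT, hKx]; exact continuous_linearisation B hBb D cν
  have hD₀ : ∀ w : W, (((D w : W) : ℓ2) : (Fin 3 → ℤ) → ℂ³) = fun k =>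
      (2 * Real.pi * Complex.I * kdot[k, mFourierCoeff (complexify ∘ u₀) 0]) • cf[((w : ℓ2) : (Fin 3 → ℤ) → ℂ³)] k :=
    fun w => by rw [hu₀0]; exact hD w
  have hinj : ∀ w : W, cν • w + (D + Kx z) w = 0 → w = 0 :=
    stub_linearisationInjective W hW B hB ν u₀ D (Kx z) z hν hu₀ (steady_isDivFree hst₀) hnd hD₀ (hKxw z) hcfz
  have hKc : IsCompactOperator (Kx z) := by
    refine isCompactOperator_linearised hWc hB z ?_ (Kx z) (hKxw z)
    rw [hcfz]
    exact rapidDecay_update hu₀.complexify_comp.rapidDecay_mFourierCoeff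
  obtain ⟨L, hL⟩ := exists_equiv_of_injective (hDc.add hKc) hcν0.ne' hinj
  have hTz : T z ∈ Set.range (ContinuousLinearEquiv.toContinuousLinearMap : (W ≃L[ℝ] W) → (W →L[ℝ] W)) := by
    refine ⟨L, ContinuousLinearMap.ext fun w => ?_⟩
    rw [ContinuousLinearEquiv.coe_coe, hTw, hL]
  -- invertibility persists along the subsequence
  have hev' : ∀ᶠ n in atTop,
      T (x (φ n)) ∈ Set.range (ContinuousLinearEquiv.toContinuousLinearMap : (W ≃L[ℝ] W) → (W →L[ℝ] W)) :=
    (hTc.tendsto z |>.comp hz).eventually_mem (ContinuousLinearEquiv.isOpen.mem_nhds hTz)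
  obtain ⟨n, L', hL'⟩ := hev'.exists
  have hinjn : Function.Injective (T (x (φ n))) := by
    rw [← hL']
    exact L'.injective
  -- but `u_{φ n}` is degenerate: a non-zero lattice kernel vector
  have hDn : ∀ w : W, (((D w : W) : ℓ2) : (Fin 3 → ℤ) → ℂ³) = fun k =>
      (2 * Real.pi * Complex.I * kdot[k, mFourierCoeff (complexify ∘ u (φ n)) 0]) • cf[((w : ℓ2) : (Fin 3 → ℤ) → ℂ³)] k :=
    fun w => by rw [hMn (φ n)]; exact hD w
  obtain ⟨w, hw0, hw⟩ := exists_kernel_of_isLinNSEigenvalue hW B hB D (Kx (x (φ n))) (x (φ n)) (hu (φ n)) hDn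
    (hKxw (x (φ n))) (hcfx (φ n)) (hev (φ n))
  refine hw0 (hinjn ?_)
  rw [hTw, hw, map_zero]

/-! ## §3 Registered sub-goal -/

/-- **Registered sub-goal `genericLeaf_open` — the OPENNESS HALF of stub B** (worker B of
`stub_genericLeafNondegeneracy`): for `ν > 0` and every momentum `m`, the admissible parameters all of
whose classical steady states of momentum `m` are leaf-nondegenerate form an open subset of `𝒜`.  With
this, stub B is reduced to the DENSITY of the same set. [folklore] -/
theorem genericLeaf_open : ∀ (ν : ℝ) (m : E³), 0 < ν → IsOpen {c : 𝒜 | ∀ (u : 𝕋³ → E³) (p : 𝕋³ → ℝ), IsSteadyNSState ν F⟦c⟧ u p → ∫ x, u x = m → ¬ IsLinNSEigenvalue ν u 0} :=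
  isOpen_leafNondegenerate

end Summit.AnomalousDissipation.AnomalousDissipation.Theorems.WindLineWindyGalerkinSteadyZerothLaw.GenericLeaf

end
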